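import Summits.CriticalPhenomena.PercolationContinuityZ3.Theorems.PercNearOneGluingNoHeavyLowerTailSunflowerGraphMarkSteps
import Summits.CriticalPhenomena.PercolationContinuityZ3.Theorems.PercNearOneGluingNoHeavyLowerTailSunflowerWindowC4ab21
import Summits.CriticalPhenomena.PercolationContinuityZ3.Theorems.PercNearOneGluingNoHeavyLowerTailSunflowerWindowC4ab23
import Summits.CriticalPhenomena.PercolationContinuityZ3.Theorems.PercNearOneGluingNoHeavyLowerTailSunflowerWindowC4ab31
import Summits.CriticalPhenomena.PercolationContinuityZ3.Theorems.PercNearOneGluingNoHeavyLowerTailSunflowerWindowPath21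
import Summits.CriticalPhenomena.PercolationContinuityZ3.Theorems.PercNearOneGluingNoHeavyLowerTailSunflowerWindowPath23
import Summits.CriticalPhenomena.PercolationContinuityZ3.Theorems.PercNearOneGluingNoHeavyLowerTailSunflowerWindowPath31
import Summits.CriticalPhenomena.PercolationContinuityZ3.Theorems.PercNearOneGluingNoHeavyLowerTailSunflowerWindowPath33
import HarnessLib

/-!
# `NoHeavyLowerTail` (crux stmt-CriticalPhenomena-4575), abstract sunflower cubic: graph-mark sunflowers — the WINDOW STEP of the structured-window
# induction for ★ (seven landed three-point certificates)

Support file (seat `prim-ineq-gen-2` gen 26; `--supports stmt-CriticalPhenomena-4575`).  No `sorry`; nothing is asserted about the crux.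
Memo: run/shared/lean/prim/prim-ineq-gen-2/GRAPHMARK-LEAN-GEN26.md.  Part 2 of 3 of the driver: `window_step` — for a window `u – p – q – r – w`
(`p q` colour `0`, `q r` colour `1`, `p u` colour `cu`, `r w` colour `cw`, `p ≁ r`, `p, q, r` unmarked with no further neighbours; `u = w` allowed)
the section labels `g1 … g7` are derived once from the local label calculus (`IsGraphMarkOn.lab_insert`, `nb_eq_ite`), the twelve minors are
nonnegative by the induction hypothesis through `IsGraphMarkOn.mono/.con`, and one of `c4a/c4b/c4c/pth21/pth23/pth31/pth33_window` applies
according to `(cu, cw) ∈ {1,2} × {0,2}` and `u = w`.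
-/

namespace Summit.CriticalPhenomena.PercolationContinuityZ3.Theorems.SunflowerPartition

open Finset

variable {α : Type*} [Fintype α] [DecidableEq α]

namespace Sunflower

variable {F : Sunflower α} {c : α → α → Option (Fin 3)} {T : α → Finset (Fin 3)} {W : Finset α}

section Steps

variable (hc : IsProperEdgeColouring c) (hF : F.IsGraphMarkOn c T W)
  (hIH : ∀ (F' : Sunflower α) (T' : α → Finset (Fin 3)) (W' : Finset α), #W' < #W → F'.IsGraphMarkOn c T' W' → 0 ≤ F'.ZP W' ∅ ∅ ∅)
include hc hF hIH

/-- A WINDOW `u – p – q – r – w` (`p q` colour `0`, `q r` colour `1`, `p u` colour `cu`, `r w` colour `cw`, `p ≁ r`; `p, q, r` unmarked with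
no further neighbours in `W`; `u = w` allowed): one of the seven landed three-point certificates applies. [this work] -/
theorem window_step {p q r u w : α} {cu cw : Fin 3}
    (hp : p ∈ W) (hq : q ∈ W) (hr : r ∈ W) (huW : u ∈ W) (hwW : w ∈ W)
    (hTp : T p = ∅) (hTq : T q = ∅) (hTr : T r = ∅)
    (h0 : c p q = some 0) (h1 : c q r = some 1) (hu : c p u = some cu) (hw : c r w = some cw) (hpr : c p r = none)
    (huq : u ≠ q) (hwq : w ≠ q)
    (hNp : ∀ y ∈ W, y ≠ q → y ≠ u → c p y = none) (hNq : ∀ y ∈ W, y ≠ p → y ≠ r → c q y = none)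
    (hNr : ∀ y ∈ W, y ≠ q → y ≠ w → c r y = none) :
    0 ≤ F.ZP W ∅ ∅ ∅ := by
  -- distinctness and colour constraints forced by properness
  have hpq : p ≠ q := hc.ne_of_some h0
  have hqr : q ≠ r := hc.ne_of_some h1
  have hup : u ≠ p := (hc.ne_of_some hu).symm
  have hwr : w ≠ r := (hc.ne_of_some hw).symm
  have hqp : c q p = some 0 := by rw [hc.symm]; exact h0
  have hrq : c r q = some 1 := by rw [hc.symm]; exact h1
  have hrp : c r p = none := by rw [hc.symm]; exact hpr
  have hpr' : p ≠ r := by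
    intro h
    rw [← h, hqp] at h1
    exact absurd (Option.some_injective _ h1) (by decide)
  have hur : u ≠ r := by
    intro h
    rw [h, hpr] at hu
    exact none_ne_some' cu hu
  have hwp : w ≠ p := by
    intro h
    rw [h, hrp] at hw
    exact none_ne_some' cw hw
  have hcu0 : cu ≠ 0 := fun h => huq (hc.proper p u q 0 (by rw [hu, h]) h0)
  have hcw1 : cw ≠ 1 := fun h => hwq (hc.proper r w q 1 (by rw [hw, h]) hrq)
  have huw_col : u = w → cu ≠ cw := by
    intro h hcol
    have hup' : c u p = some cu := by rw [hc.symm]; exact hu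
    have hur' : c u r = some cu := by rw [h, hc.symm, hcol]; exact hw
    exact hpr' (hc.proper u p r cu hup' hur')
  -- the window `W'`
  set W' : Finset α := ((W.erase p).erase q).erase r with hW'
  have hq1 : q ∈ W.erase p := mem_erase.2 ⟨hpq.symm, hq⟩
  have hr2 : r ∈ (W.erase p).erase q := mem_erase.2 ⟨hqr.symm, mem_erase.2 ⟨hpr'.symm, hr⟩⟩
  have hWeq : insert p (insert q (insert r W')) = W := by rw [hW', insert_erase hr2, insert_erase hq1, insert_erase hp]
  have hmemW' : ∀ x, x ∈ W' ↔ x ≠ r ∧ x ≠ q ∧ x ≠ p ∧ x ∈ W := fun x => by rw [hW', mem_erase, mem_erase, mem_erase]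
  have hW'W : W' ⊆ W := fun x hx => ((hmemW' x).1 hx).2.2.2
  have hW'p : W' ⊆ W.erase p := fun x hx => mem_erase.2 ⟨((hmemW' x).1 hx).2.2.1, ((hmemW' x).1 hx).2.2.2⟩
  have hpW' : p ∉ W' := fun h => ((hmemW' p).1 h).2.2.1 rfl
  have hqW' : q ∉ W' := fun h => ((hmemW' q).1 h).2.1 rfl
  have hrW' : r ∉ W' := fun h => ((hmemW' r).1 h).1 rfl
  have huW' : u ∈ W' := (hmemW' u).2 ⟨hur, huq, hup, huW⟩
  have hwW' : w ∈ W' := (hmemW' w).2 ⟨hwr, hwq, hwp, hwW⟩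
  have hcard : #W' + 3 = #W := by
    have h3 : #({p, q, r} : Finset α) = 3 := card_eq_three.2 ⟨p, q, r, hpq, hpr', hqr, rfl⟩
    have h3le : #({p, q, r} : Finset α) ≤ #W :=
      card_le_card (insert_subset hp (insert_subset hq (singleton_subset_iff.2 hr)))
    rw [hW', card_erase_of_mem hr2, card_erase_of_mem hq1, card_erase_of_mem hp]
    omega
  have hXW : ∀ X ⊆ W', X ⊆ W := fun X hX => hX.trans hW'W
  have hqrW' : q ∉ insert r W' := fun h => by
    rcases mem_insert.1 h with h | h
    · exact hqr h
    · exact hqW' h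
  have hprW' : p ∉ insert r W' := fun h => by
    rcases mem_insert.1 h with h | h
    · exact hpr' h
    · exact hpW' h
  have hpqW' : p ∉ insert q W' := fun h => by
    rcases mem_insert.1 h with h | h
    · exact hpq h
    · exact hpW' h
  -- neighbourhoods seen from inside the window
  have hNpX : ∀ X ⊆ W', ∀ y ∈ X, y ≠ u → c p y = none := fun X hX y hy hyu =>
    hNp y (hXW X hX hy) (fun h => hqW' (h ▸ hX hy)) hyu
  have hNqX : ∀ X ⊆ W', ∀ y ∈ X, c q y = none := fun X hX y hy =>
    hNq y (hXW X hX hy) (fun h => hpW' (h ▸ hX hy)) (fun h => hrW' (h ▸ hX hy))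
  have hNrX : ∀ X ⊆ W', ∀ y ∈ X, y ≠ w → c r y = none := fun X hX y hy hyw =>
    hNr y (hXW X hX hy) (fun h => hqW' (h ▸ hX hy)) hyw
  -- the section labels (generic in `cu`, `cw`)
  have g1 : ∀ X ⊆ W', F.lab (insert p X) = if u ∈ X then jn (F.lab X) (petalOf cu) else F.lab X := by
    intro X hX
    rw [hF.lab_insert hc.symm hc.irrefl hp hTp (hXW X hX), nb_eq_ite hu (hNpX X hX)]
    split_ifs <;> simp only [theta_singleton, theta_empty, joinM_petalOf, joinM_zero_right]
  have g2 : ∀ X ⊆ W', F.lab (insert q X) = F.lab X := by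
    intro X hX
    rw [hF.lab_insert hc.symm hc.irrefl hq hTq (hXW X hX), nb_eq_empty (hNqX X hX), theta_empty, joinM_zero_right]
  have g4 : ∀ X ⊆ W', F.lab (insert r X) = if w ∈ X then jn (F.lab X) (petalOf cw) else F.lab X := by
    intro X hX
    rw [hF.lab_insert hc.symm hc.irrefl hr hTr (hXW X hX), nb_eq_ite hw (hNrX X hX)]
    split_ifs <;> simp only [theta_singleton, theta_empty, joinM_petalOf, joinM_zero_right]
  have g3 : ∀ X ⊆ W', F.lab (insert p (insert q X)) = if u ∈ X then 4 else jn (F.lab X) (petalOf 0) := by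
    intro X hX
    rw [hF.lab_insert hc.symm hc.irrefl hp hTp (insert_subset hq (hXW X hX)), nb_insert, h0, Option.toFinset_some,
      nb_eq_ite hu (hNpX X hX), g2 X hX]
    split_ifs
    · rw [theta_singleton_union_singleton 0 cu hcu0.symm, joinM_four_right]
    · rw [union_empty, theta_singleton, joinM_petalOf]
  have g6 : ∀ X ⊆ W', F.lab (insert q (insert r X)) = if w ∈ X then 4 else jn (F.lab X) (petalOf 1) := by
    intro X hX
    rw [hF.lab_insert hc.symm hc.irrefl hq hTq (insert_subset hr (hXW X hX)), nb_insert, h1, Option.toFinset_some,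
      nb_eq_empty (hNqX X hX), union_empty, theta_singleton, joinM_petalOf, g4 X hX]
    split_ifs
    · exact jn_jn_petalOf_of_ne _ cw 1 hcw1
    · rfl
  have g5 : ∀ X ⊆ W', F.lab (insert p (insert r X)) =
      if u ∈ X then (if w ∈ X then jn (jn (F.lab X) (petalOf cw)) (petalOf cu) else jn (F.lab X) (petalOf cu))
      else (if w ∈ X then jn (F.lab X) (petalOf cw) else F.lab X) := by
    intro X hX
    rw [hF.lab_insert hc.symm hc.irrefl hp hTp (insert_subset hr (hXW X hX)), nb_insert, hpr, Option.toFinset_none,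
      empty_union, nb_eq_ite hu (hNpX X hX), g4 X hX]
    split_ifs <;> simp only [theta_singleton, theta_empty, joinM_petalOf, joinM_zero_right]
  have g7 : ∀ X ⊆ W', F.lab (insert p (insert q (insert r X))) = 4 := by
    intro X hX
    rw [hF _ (insert_subset hp (insert_subset hq (insert_subset hr (hXW X hX))))]
    exact theta_eq_four_of_mem _ 0 1 (by decide)
      (mem_cols_of_edge (mem_insert_self p _) (mem_insert_of_mem (mem_insert_self q _)) h0)
      (mem_cols_of_edge (mem_insert_of_mem (mem_insert_self q _))
        (mem_insert_of_mem (mem_insert_of_mem (mem_insert_self r X))) h1)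
  -- the twelve minors are nonnegative (induction hypothesis inside the class)
  have cP : (F.con p).IsGraphMarkOn c (addMarks c T p) (W.erase p) := hF.con hc.symm hc.irrefl hp hTp (erase_subset p W)
  have cQ : (F.con q).IsGraphMarkOn c (addMarks c T q) (W.erase q) := hF.con hc.symm hc.irrefl hq hTq (erase_subset q W)
  have cR : (F.con r).IsGraphMarkOn c (addMarks c T r) (W.erase r) := hF.con hc.symm hc.irrefl hr hTr (erase_subset r W)
  have hTr' : addMarks c T p r = ∅ := by
    show T r ∪ (c p r).toFinset = ∅
    rw [hTr, hpr, Option.toFinset_none, empty_union]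
  have cPR : ((F.con p).con r).IsGraphMarkOn c (addMarks c (addMarks c T p) r) W' :=
    cP.con hc.symm hc.irrefl (mem_erase.2 ⟨hpr'.symm, hr⟩) hTr' hW'p
  have eP : ∀ x, x ≠ p → x ∈ W → ∀ Y, Y ⊆ W' → insert x Y ⊆ W.erase p := fun x hx hxW Y hY =>
    insert_subset (mem_erase.2 ⟨hx, hxW⟩) (hY.trans hW'p)
  have hW'q : W' ⊆ W.erase q := fun x hx => mem_erase.2 ⟨((hmemW' x).1 hx).2.1, ((hmemW' x).1 hx).2.2.2⟩
  have hW'r : W' ⊆ W.erase r := fun x hx => mem_erase.2 ⟨((hmemW' x).1 hx).1, ((hmemW' x).1 hx).2.2.2⟩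
  have eQ : ∀ x, x ≠ q → x ∈ W → insert x W' ⊆ W.erase q := fun x hx hxW =>
    insert_subset (mem_erase.2 ⟨hx, hxW⟩) hW'q
  have eR : ∀ x, x ≠ r → x ∈ W → insert x W' ⊆ W.erase r := fun x hx hxW =>
    insert_subset (mem_erase.2 ⟨hx, hxW⟩) hW'r
  have c1q : #(insert q W') = #W' + 1 := card_insert_of_notMem hqW'
  have c1r : #(insert r W') = #W' + 1 := card_insert_of_notMem hrW'
  have c1p : #(insert p W') = #W' + 1 := card_insert_of_notMem hpW'
  have c2qr : #(insert q (insert r W')) = #W' + 2 := by rw [card_insert_of_notMem hqrW', c1r]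
  have c2pr : #(insert p (insert r W')) = #W' + 2 := by rw [card_insert_of_notMem hprW', c1r]
  have c2pq : #(insert p (insert q W')) = #W' + 2 := by rw [card_insert_of_notMem hpqW', c1q]
  have hrP : r ∈ W.erase p := mem_erase.2 ⟨hpr'.symm, hr⟩
  have hrQ : r ∈ W.erase q := mem_erase.2 ⟨hqr.symm, hr⟩
  have hpQ : p ∈ W.erase q := mem_erase.2 ⟨hpq, hp⟩
  have hqR : q ∈ W.erase r := mem_erase.2 ⟨hqr, hq⟩
  have hpR : p ∈ W.erase r := mem_erase.2 ⟨hpr', hp⟩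
  have mP0 : 0 ≤ (F.con p).ZP W' ∅ ∅ ∅ := hIH _ _ _ (by omega) (cP.mono hW'p)
  have mPq : 0 ≤ (F.con p).ZP (insert q W') ∅ ∅ ∅ := hIH _ _ _ (by omega) (cP.mono (insert_subset hq1 hW'p))
  have mPr : 0 ≤ (F.con p).ZP (insert r W') ∅ ∅ ∅ := hIH _ _ _ (by omega) (cP.mono (insert_subset hrP hW'p))
  have mQr : 0 ≤ (F.con q).ZP (insert r W') ∅ ∅ ∅ := hIH _ _ _ (by omega) (cQ.mono (insert_subset hrQ hW'q))
  have mQp : 0 ≤ (F.con q).ZP (insert p W') ∅ ∅ ∅ := hIH _ _ _ (by omega) (cQ.mono (insert_subset hpQ hW'q))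
  have mR0 : 0 ≤ (F.con r).ZP W' ∅ ∅ ∅ := hIH _ _ _ (by omega) (cR.mono hW'r)
  have mRq : 0 ≤ (F.con r).ZP (insert q W') ∅ ∅ ∅ := hIH _ _ _ (by omega) (cR.mono (insert_subset hqR hW'r))
  have mRp : 0 ≤ (F.con r).ZP (insert p W') ∅ ∅ ∅ := hIH _ _ _ (by omega) (cR.mono (insert_subset hpR hW'r))
  have mPR : 0 ≤ ((F.con p).con r).ZP W' ∅ ∅ ∅ := hIH _ _ _ (by omega) cPR
  have mDp : 0 ≤ F.ZP (insert q (insert r W')) ∅ ∅ ∅ := hIH _ _ _ (by omega) (hF.mono (insert_subset hq (insert_subset hr hW'W)))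
  have mDq : 0 ≤ F.ZP (insert p (insert r W')) ∅ ∅ ∅ := hIH _ _ _ (by omega) (hF.mono (insert_subset hp (insert_subset hr hW'W)))
  have mDr : 0 ≤ F.ZP (insert p (insert q W')) ∅ ∅ ∅ := hIH _ _ _ (by omega) (hF.mono (insert_subset hp (insert_subset hq hW'W)))
  -- the seven colour / coincidence patterns
  have key0 : ∀ x : Fin 3, x ≠ 0 → x = 1 ∨ x = 2 := by decide
  have key1 : ∀ x : Fin 3, x ≠ 1 → x = 0 ∨ x = 2 := by decide
  rcases key0 cu hcu0 with hcu | hcu <;> rcases key1 cw hcw1 with hcw | hcw <;> subst hcu <;> subst hcw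
  · -- (cu, cw) = (1, 0): C4ab21 / Path21
    by_cases huw : u = w
    · subst huw
      have hb := F.c4a_window W' hpq hpr' hqr hpW' hqW' hrW' huW'
        (fun X hX => by rw [g1 X hX, petalOf_one]) g2
        (fun X hX => by rw [g3 X hX, petalOf_zero])
        (fun X hX => by rw [g4 X hX, petalOf_zero])
        (fun X hX => by
          rw [g5 X hX]
          split_ifs <;> first | rfl | exact jn_jn_petalOf_of_ne _ _ _ (by decide))
        (fun X hX => by rw [g6 X hX, petalOf_one]) g7
      rw [hWeq] at hb
      linarith
    · have hb := F.pth21_window W' hpq hpr' hqr hpW' hqW' hrW' huW' hwW'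
        (fun X hX => by rw [g1 X hX, petalOf_one]) g2
        (fun X hX => by rw [g3 X hX, petalOf_zero])
        (fun X hX => by rw [g4 X hX, petalOf_zero])
        (fun X hX => by rw [g5 X hX, jn_jn_petalOf_of_ne _ 0 1 (by decide), petalOf_zero, petalOf_one])
        (fun X hX => by rw [g6 X hX, petalOf_one]) g7
      rw [hWeq] at hb
      linarith
  · -- (cu, cw) = (1, 2): C4ab23 / Path23
    by_cases huw : u = w
    · subst huw
      have hb := F.c4b_window W' hpq hpr' hqr hpW' hqW' hrW' huW'
        (fun X hX => by rw [g1 X hX, petalOf_one]) g2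
        (fun X hX => by rw [g3 X hX, petalOf_zero])
        (fun X hX => by rw [g4 X hX, petalOf_two])
        (fun X hX => by
          rw [g5 X hX]
          split_ifs <;> first | rfl | exact jn_jn_petalOf_of_ne _ _ _ (by decide))
        (fun X hX => by rw [g6 X hX, petalOf_one]) g7
      rw [hWeq] at hb
      linarith
    · have hb := F.pth23_window W' hpq hpr' hqr hpW' hqW' hrW' huW' hwW'
        (fun X hX => by rw [g1 X hX, petalOf_one]) g2
        (fun X hX => by rw [g3 X hX, petalOf_zero])
        (fun X hX => by rw [g4 X hX, petalOf_two])
        (fun X hX => by rw [g5 X hX, jn_jn_petalOf_of_ne _ 2 1 (by decide), petalOf_one, petalOf_two])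
        (fun X hX => by rw [g6 X hX, petalOf_one]) g7
      rw [hWeq] at hb
      linarith
  · -- (cu, cw) = (2, 0): C4ab31 / Path31
    by_cases huw : u = w
    · subst huw
      have hb := F.c4c_window W' hpq hpr' hqr hpW' hqW' hrW' huW'
        (fun X hX => by rw [g1 X hX, petalOf_two]) g2
        (fun X hX => by rw [g3 X hX, petalOf_zero])
        (fun X hX => by rw [g4 X hX, petalOf_zero])
        (fun X hX => by
          rw [g5 X hX]
          split_ifs <;> first | rfl | exact jn_jn_petalOf_of_ne _ _ _ (by decide))
        (fun X hX => by rw [g6 X hX, petalOf_one]) g7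
      rw [hWeq] at hb
      linarith
    · have hb := F.pth31_window W' hpq hpr' hqr hpW' hqW' hrW' huW' hwW'
        (fun X hX => by rw [g1 X hX, petalOf_two]) g2
        (fun X hX => by rw [g3 X hX, petalOf_zero])
        (fun X hX => by rw [g4 X hX, petalOf_zero])
        (fun X hX => by rw [g5 X hX, jn_jn_petalOf_of_ne _ 0 2 (by decide), petalOf_zero, petalOf_two])
        (fun X hX => by rw [g6 X hX, petalOf_one]) g7
      rw [hWeq] at hb
      linarith
  · -- (cu, cw) = (2, 2): Path33 (`u = w` is impossible: properness at `u`)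
    by_cases huw : u = w
    · exact (huw_col huw rfl).elim
    · have hb := F.pth33_window W' hpq hpr' hqr hpW' hqW' hrW' huW' hwW'
        (fun X hX => by rw [g1 X hX, petalOf_two]) g2
        (fun X hX => by rw [g3 X hX, petalOf_zero])
        (fun X hX => by rw [g4 X hX, petalOf_two])
        (fun X hX => by rw [g5 X hX, jn_jn_petalOf_same, petalOf_two, ite_self])
        (fun X hX => by rw [g6 X hX, petalOf_one]) g7
      rw [hWeq] at hb
      linarith

end Steps

end Sunflower

end Summit.CriticalPhenomena.PercolationContinuityZ3.Theorems.SunflowerPartition
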